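import Literature.Analysis.FluidPDE.ConeCarlemanSecond
import Literature.Analysis.FluidPDE.BackwardUniquenessCoreC12
import HarnessLib

/-!
# The cone Carleman inequality in the class `C¹₂` and for cut-off products

Analysis/FluidPDE support file (theorems only; no definitions, no named facts) for the proof of
Li–Šverák's backward-uniqueness theorem in cones
(`Literature.Analysis.FluidPDE.coneBackwardUniquenessC12`). The smooth cone Carleman inequality
`carleman_inequality_cone` (`ConeCarlemanSecond`, [LiSverak2012, Prop. 2.3]) is transported to
the regularity class `C¹ ∩ {∂ₓu ∈ C¹}` of the tree's backward-uniqueness chain by the density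
theorem `weightedIneq_of_c12` (`carleman_inequality_cone_of_c12`), and then applied to a cut-off
product `w = χv` of a solution `v` of the differential inequality `|∂ₛv + Δv| ≤ c(|v| + |∇v|)`,
with the lower-order terms absorbed exactly as in (2.14)–(2.17) of the paper
(`cone_carleman_smul_le_c12`, the cone analogue of `carleman_second_smul_le_c12`).

## References

* [LiSverak2012] Lu Li, V. Šverák, *Backward uniqueness for the heat equation in cones*,
  Comm. PDE 37 (2012), 1414–1429, arXiv:1011.2796 — Prop. 2.3, Lemma 2.4.
* [ESS2003] L. Escauriaza, G. Seregin, V. Šverák, *`L_{3,∞}`-solutions of Navier–Stokes equations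
  and backward uniqueness*, Russ. Math. Surv. 58 (2003) — §§4–5 (the half-space template).
-/

noncomputable section

open MeasureTheory Set Function Filter
open _root_.Topology
open scoped InnerProductSpace RealInnerProductSpace

namespace Literature.Analysis.FluidPDE

namespace Carleman

/-! ## The cone Carleman inequality in the class `C¹₂` and for cut-off products -/

section ConeCarlemanC12

variable {E : Type*} [NormedAddCommGroup E] [InnerProductSpace ℝ E] [FiniteDimensional ℝ E]
  [MeasurableSpace E] [BorelSpace E]
variable {F : Type*} [NormedAddCommGroup F] [InnerProductSpace ℝ F] [CompleteSpace F]

omit [FiniteDimensional ℝ E] [MeasurableSpace E] [BorelSpace E] in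
/-- The truncated cone `{ε|x| < ⟪x,e⟫} ∩ {⟪x,e⟫ > 1}` is open. [folklore] -/
theorem isOpen_coneCap (ε : ℝ) (e : E) : IsOpen {x : E | ε * ‖x‖ < ⟪x, e⟫ ∧ 1 < ⟪x, e⟫} := by
  rw [Set.setOf_and]
  exact (isOpen_lt (continuous_const.mul continuous_norm) (continuous_id.inner continuous_const)).inter
    (isOpen_lt continuous_const (continuous_id.inner continuous_const))

omit [FiniteDimensional ℝ E] [MeasurableSpace E] [BorelSpace E] in
/-- The zeroth-order weight `Z(t,x) = (c₂/2)a²k₁(t) + aφ₀(x)` is continuous on `{t > 0} × E`. [folklore] -/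
theorem continuousOn_coneZ (a β η c : ℝ) (hβ : 0 < β) (e : E) :
    ContinuousOn (fun z : ℝ × E => c / 2 * a ^ 2 * kA 1 z.1 + a * conePhi0 β η e z.2) {z | 0 < z.1} := by
  have cφ0 : Continuous fun z : ℝ × E => conePhi0 β η e z.2 := by
    unfold conePhi0
    exact ((continuous_snd.inner continuous_const).rpow_const fun _ => Or.inr (by linarith)).sub
      (continuous_const.mul ((continuous_snd.norm.pow 2).rpow_const fun _ => Or.inr (by linarith)))
  exact (continuousOn_const.mul ((contDiffOn_kA 1).continuousOn.comp continuous_fst.continuousOn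
    fun z hz => hz)).add (continuousOn_const.mul cφ0.continuousOn)

/-- **The cone Carleman inequality (`carleman_inequality_cone`) in the class `C¹ ∩ {∂ₓu ∈ C¹}`**
(density, `weightedIneq_of_c12`): for compactly supported `u ∈ C¹` with `∂ₑu ∈ C¹`, support in
`]0,1[ × ({ε|x| < ⟪x,e⟫} ∩ {⟪x,e⟫ > 1})`,
`∫ (Z e^{2φ}|u|² + ½ t e^{2φ}|∇u|²) ≤ ∫ t² e^{2φ}|∂ₜu + Δu|²`. [cite: LiSverak2012, Prop. 2.3] -/
theorem carleman_inequality_cone_of_c12 {β ε η a : ℝ} (hβ : 1 / 2 < β) (hβ1 : β ≤ 1) (hε0 : 0 ≤ ε)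
    (hη : η = ε ^ (2 * β)) (hκ : 0 ≤ 2 * β - 1 - 2 * η)
    (hm : 0 ≤ (2 * β - 1 - 2 * η) * (1 - η) ^ 2 - 2 * η * ε ^ 2 * (1 - ε ^ 2))
    (hc₂ : 0 < 8 * β ^ 2 * (1 - η) ^ 2 - 8 * β * η * (1 - η) - 4 * β ^ 2 * η ^ 2) (ha0 : 0 ≤ a)
    (ha : 2 * ((1 - β) * (9 * ((Module.finrank ℝ E : ℝ) + 4) ^ 2)) ≤
      a * (8 * β ^ 2 * (1 - η) ^ 2 - 8 * β * η * (1 - η) - 4 * β ^ 2 * η ^ 2))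
    {e : E} (he : ‖e‖ = 1) {U : ℝ × E → F} (hU1 : ContDiff ℝ 1 U)
    (hdx1 : ∀ e' : E, ContDiff ℝ 1 (dx e' U)) (hUc : HasCompactSupport U)
    (hUs : tsupport U ⊆ Ioo (0 : ℝ) 1 ×ˢ {x : E | ε * ‖x‖ < ⟪x, e⟫ ∧ 1 < ⟪x, e⟫}) :
    ∫ z, ((8 * β ^ 2 * (1 - η) ^ 2 - 8 * β * η * (1 - η) - 4 * β ^ 2 * η ^ 2) / 2 * a ^ 2 * kA 1 z.1 +
          a * conePhi0 β η e z.2) * Real.exp (2 * conePhi a β η e z) * ‖U z‖ ^ 2 +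
        1 / 2 * z.1 * Real.exp (2 * conePhi a β η e z) * gradSq U z ≤
      1 * ∫ z, z.1 ^ 2 * Real.exp (2 * conePhi a β η e z) * ‖dt U z + lap U z‖ ^ 2 := by
  set O : Set (ℝ × E) := Ioo (0 : ℝ) 1 ×ˢ {x : E | ε * ‖x‖ < ⟪x, e⟫ ∧ 1 < ⟪x, e⟫} with hO
  have hOo : IsOpen O := isOpen_Ioo.prod (isOpen_coneCap ε e)
  have hOΩ : O ⊆ halfDom e := fun z hz => ⟨hz.1.1, lt_trans zero_lt_one hz.2.2⟩
  set W : ℝ × E → ℝ := fun z => Real.exp (2 * conePhi a β η e z) with hW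
  have cφ : ContinuousOn (conePhi a β η e) O := (contDiffOn_conePhi a β η e).continuousOn.mono hOΩ
  have cW : ContinuousOn W O := (continuousOn_const.mul cφ).rexp
  have cZ := (continuousOn_coneZ a β η (8 * β ^ 2 * (1 - η) ^ 2 - 8 * β * η * (1 - η) - 4 * β ^ 2 * η ^ 2)
    (by linarith) e).mono (fun z hz => hz.1.1 : O ⊆ {z : ℝ × E | 0 < z.1})
  have cw₁ : ContinuousOn (fun z => ((8 * β ^ 2 * (1 - η) ^ 2 - 8 * β * η * (1 - η) - 4 * β ^ 2 * η ^ 2) / 2 *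
      a ^ 2 * kA 1 z.1 + a * conePhi0 β η e z.2) * W z) O := cZ.mul cW
  have cw₂ : ContinuousOn (fun z => 1 / 2 * z.1 * W z) O := (continuousOn_const.mul continuous_fst.continuousOn).mul cW
  have cw₃ : ContinuousOn (fun z => z.1 ^ 2 * W z) O := (continuous_fst.pow 2).continuousOn.mul cW
  -- the smooth case, with the left-hand side as one integral
  have H : ∀ V : ℝ × E → F, ContDiff ℝ (⊤ : ℕ∞) V → HasCompactSupport V → tsupport V ⊆ O →
      ∫ z, (((8 * β ^ 2 * (1 - η) ^ 2 - 8 * β * η * (1 - η) - 4 * β ^ 2 * η ^ 2) / 2 * a ^ 2 * kA 1 z.1 +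
          a * conePhi0 β η e z.2) * W z * ‖V z‖ ^ 2 + 1 / 2 * z.1 * W z * gradSq V z) ≤
        1 * ∫ z, z.1 ^ 2 * W z * ‖dt V z + lap V z‖ ^ 2 := by
    intro V hV hVc hVs
    have h := carleman_inequality_cone hβ hβ1 hε0 hη hκ hm hc₂ ha0 ha he hV hVc hVs
    have hV0 : ∀ z ∉ tsupport V, V z = 0 := fun z hz => image_eq_zero_of_notMem_tsupport hz
    have hdV0 : ∀ z ∉ tsupport V, fderiv ℝ V z = 0 := fun z hz => fderiv_of_notMem_tsupport (𝕜 := ℝ) hz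
    have hg0 : ∀ z ∉ tsupport V, gradSq V z = 0 := fun z hz => by simp [gradSq, dx, hdV0 z hz]
    have cgV : Continuous (gradSq V) := by
      unfold gradSq
      exact continuous_finsetSum _ fun i _ => ((contDiff_dx hV _).continuous.norm.pow 2)
    have i1 : Integrable fun z => ((8 * β ^ 2 * (1 - η) ^ 2 - 8 * β * η * (1 - η) - 4 * β ^ 2 * η ^ 2) / 2 *
        a ^ 2 * kA 1 z.1 + a * conePhi0 β η e z.2) * W z * ‖V z‖ ^ 2 :=
      integrable_weight_mul hOo hVc hVs cw₁ (hV.continuous.norm.pow 2) fun z hz => by simp [hV0 z hz]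
    have i2 : Integrable fun z => 1 / 2 * z.1 * W z * gradSq V z :=
      integrable_weight_mul hOo hVc hVs cw₂ cgV hg0
    rw [integral_add i1 i2, one_mul]
    have e2 : ∫ z, 1 / 2 * z.1 * W z * gradSq V z = 1 / 2 * ∫ z, z.1 * Real.exp (2 * conePhi a β η e z) * gradSq V z := by
      rw [← integral_const_mul]
      exact integral_congr_ae (Eventually.of_forall fun z => by simp only [hW]; ring)
    rw [e2]
    simpa only [hW] using h
  have h := weightedIneq_of_c12 hOo cw₁ cw₂ cw₃ H hU1 hdx1 hUc hUs
  simpa only [hW] using h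

/-- **The cone Carleman inequality for a cut-off product `w = ηv`, lower-order terms absorbed**
(Li–Šverák 2012, proof of Lemma 2.4, (2.14)–(2.17): "`I ≡ ∫ e^{2aφ_B}(w² + |∇w|²) ≤ 32c₄² ∫ …`"),
in the class `C¹₂`: let the parameters be as in `carleman_inequality_cone`, `η ∈ C²_c` with
`tsupport η ⊆ ]1/2, 1[ × ({ε|y| < ⟪y,e⟫} ∩ {⟪y,e⟫ > 1})` and `tsupport η ⊆ O`, `η ≥ 0`, the
zeroth-order weight `Z ≥ 1` on `tsupport η` (this is the paper's "for `a` large enough,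
`a(Λ + φ) > 1`"), and `v ∈ C¹(O)`, `∂ₑv ∈ C¹(O)` with `|∂ₛv + Δv| ≤ c(|v| + |∇v|)` on `O`,
`c² ≤ 1/96`. Then for every measurable `G` on which `η = 1`, with `W = e^{2φ}`,
`∫_G W|v|² ≤ ∫ W|∇η|²|v|² + 6∫ W(∂ₛη + Δη)²|v|² + 24∫ W|∇η|²|∇v|²`. [cite: LiSverak2012, Lemma 2.4 (2.14)–(2.17)] -/
theorem cone_carleman_smul_le_c12 {β ε η a : ℝ} (hβ : 1 / 2 < β) (hβ1 : β ≤ 1) (hε0 : 0 ≤ ε)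
    (hηε : η = ε ^ (2 * β)) (hκ : 0 ≤ 2 * β - 1 - 2 * η)
    (hm : 0 ≤ (2 * β - 1 - 2 * η) * (1 - η) ^ 2 - 2 * η * ε ^ 2 * (1 - ε ^ 2))
    (hc₂ : 0 < 8 * β ^ 2 * (1 - η) ^ 2 - 8 * β * η * (1 - η) - 4 * β ^ 2 * η ^ 2) (ha0 : 0 ≤ a)
    (ha : 2 * ((1 - β) * (9 * ((Module.finrank ℝ E : ℝ) + 4) ^ 2)) ≤
      a * (8 * β ^ 2 * (1 - η) ^ 2 - 8 * β * η * (1 - η) - 4 * β ^ 2 * η ^ 2))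
    {e : E} (he : ‖e‖ = 1) {χ : ℝ × E → ℝ} {v : ℝ × E → F} {O : Set (ℝ × E)} {c : ℝ}
    (hO : IsOpen O) (hv : ContDiffOn ℝ 1 v O) (hvx : ∀ e' : E, ContDiffOn ℝ 1 (dx e' v) O)
    (hBH : ∀ z ∈ O, ‖dt v z + lap v z‖ ≤ c * (‖v z‖ + Real.sqrt (gradSq v z)))
    (hc : c ^ 2 ≤ 1 / 96) (hχ : ContDiff ℝ 2 χ) (hχc : HasCompactSupport χ)
    (hχs : tsupport χ ⊆ Ioo (1 / 2 : ℝ) 1 ×ˢ {x : E | ε * ‖x‖ < ⟪x, e⟫ ∧ 1 < ⟪x, e⟫})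
    (hχO : tsupport χ ⊆ O) (hχ0 : ∀ z, 0 ≤ χ z)
    (hZ : ∀ z ∈ tsupport χ, 1 ≤ (8 * β ^ 2 * (1 - η) ^ 2 - 8 * β * η * (1 - η) - 4 * β ^ 2 * η ^ 2) / 2 *
      a ^ 2 * kA 1 z.1 + a * conePhi0 β η e z.2)
    {G : Set (ℝ × E)} (hGm : MeasurableSet G) (hG1 : ∀ z ∈ G, χ z = 1) :
    ∫ z in G, Real.exp (2 * conePhi a β η e z) * ‖v z‖ ^ 2 ≤
      (∫ z, Real.exp (2 * conePhi a β η e z) * (gradSq χ z * ‖v z‖ ^ 2)) +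
      6 * (∫ z, Real.exp (2 * conePhi a β η e z) * ((dt χ z + lap χ z) ^ 2 * ‖v z‖ ^ 2)) +
      24 * ∫ z, Real.exp (2 * conePhi a β η e z) * (gradSq χ z * gradSq v z) := by
  -- ### geometry
  set Q : Set (ℝ × E) := Ioo (0 : ℝ) 1 ×ˢ {x : E | ε * ‖x‖ < ⟪x, e⟫ ∧ 1 < ⟪x, e⟫} with hQ
  set Ω : Set (ℝ × E) := Ioo (1 / 2 : ℝ) 1 ×ˢ {x : E | ε * ‖x‖ < ⟪x, e⟫ ∧ 1 < ⟪x, e⟫} with hΩ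
  have hΩo : IsOpen Ω := isOpen_Ioo.prod (isOpen_coneCap ε e)
  have hΩQ : Ω ⊆ Q := Set.prod_mono (fun t ht => ⟨by linarith [ht.1], ht.2⟩) Subset.rfl
  have hΩh : Ω ⊆ halfDom e := fun z hz => ⟨by linarith [hz.1.1], lt_trans zero_lt_one hz.2.2⟩
  have hTc : IsCompact (tsupport χ) := hχc
  have hTΩ : tsupport χ ⊆ Ω := hχs
  have hTO : tsupport χ ⊆ O := hχO
  set W : ℝ × E → ℝ := fun z => Real.exp (2 * conePhi a β η e z) with hWdef
  set Zw : ℝ × E → ℝ := fun z => (8 * β ^ 2 * (1 - η) ^ 2 - 8 * β * η * (1 - η) - 4 * β ^ 2 * η ^ 2) / 2 *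
      a ^ 2 * kA 1 z.1 + a * conePhi0 β η e z.2 with hZwdef
  have cφ : ContinuousOn (conePhi a β η e) Ω := (contDiffOn_conePhi a β η e).continuousOn.mono hΩh
  have hWc : ContinuousOn W Ω := (continuousOn_const.mul cφ).rexp
  have hW0 : ∀ z, 0 ≤ W z := fun z => (Real.exp_pos _).le
  have cZ : ContinuousOn Zw Ω := (continuousOn_coneZ a β η _ (by linarith) e).mono fun z hz => by
    show (0 : ℝ) < z.1; linarith [hz.1.1]
  -- ### `w = χ v`
  set w : ℝ × E → F := fun z => χ z • v z with hw
  have hw0 : ∀ z ∉ tsupport χ, w z = 0 := fun z hz => by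
    simp [hw, image_eq_zero_of_notMem_tsupport hz]
  have hwK : tsupport w ⊆ tsupport χ := by
    refine closure_minimal (fun z hz => ?_) (isClosed_tsupport χ)
    by_contra h
    exact hz (hw0 z h)
  have hw1 : ContDiff ℝ 1 w := contDiff_one_cutoff_smul_c12 hO hχ hTO hv
  have hwx : ∀ e' : E, ContDiff ℝ 1 (dx e' w) := fun e' =>
    contDiff_one_dx_cutoff_smul_c12 hO hχ hTO hv hvx e'
  have hwc : HasCompactSupport w := hχc.mono' ((subset_tsupport _).trans hwK)
  have hws : tsupport w ⊆ Q := hwK.trans (hχs.trans hΩQ)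
  -- ### vanishing off `tsupport χ`
  have hχd0 : ∀ z ∉ tsupport χ, fderiv ℝ χ z = 0 := fun z hz =>
    fderiv_of_notMem_tsupport (𝕜 := ℝ) hz
  have hgχ0 : ∀ z ∉ tsupport χ, gradSq χ z = 0 := fun z hz => by simp [gradSq, dx, hχd0 z hz]
  have hlapχ0 : ∀ z ∉ tsupport χ, lap χ z = 0 := fun z hz =>
    image_eq_zero_of_notMem_tsupport fun h => hz (tsupport_lap_subset χ h)
  have hdtχ0 : ∀ z ∉ tsupport χ, dt χ z = 0 := fun z hz => by simp [dt, hχd0 z hz]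
  have hwd0 : ∀ z ∉ tsupport χ, fderiv ℝ w z = 0 := fun z hz =>
    fderiv_of_notMem_tsupport (𝕜 := ℝ) fun h => hz (hwK h)
  have hgw0 : ∀ z ∉ tsupport χ, gradSq w z = 0 := fun z hz => by simp [gradSq, dx, hwd0 z hz]
  have hlapw0 : ∀ z ∉ tsupport χ, lap w z = 0 := fun z hz =>
    image_eq_zero_of_notMem_tsupport fun h => hz (hwK (tsupport_lap_subset w h))
  have hdtw0 : ∀ z ∉ tsupport χ, dt w z = 0 := fun z hz => by simp [dt, hwd0 z hz]
  have hPw0 : ∀ z ∉ tsupport χ, dt w z + lap w z = 0 := fun z hz => by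
    rw [hdtw0 z hz, hlapw0 z hz, add_zero]
  -- ### continuity
  have cw : Continuous w := hw1.continuous
  have cfdr : ∀ {f : ℝ × E → ℝ}, ContDiff ℝ 2 f → ∀ u : ℝ × E, Continuous fun z => fderiv ℝ f z u :=
    fun hf u => (hf.continuous_fderiv (by norm_num)).clm_apply continuous_const
  have cfd2r : ∀ {f : ℝ × E → ℝ}, ContDiff ℝ 2 f → ∀ u u' : ℝ × E,
      Continuous fun z => fderiv ℝ (fun y => fderiv ℝ f y u) z u' := by
    intro f hf u u'
    have h1 : ContDiff ℝ 1 fun y => fderiv ℝ f y u :=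
      (hf.fderiv_right (m := 1) le_rfl).clm_apply contDiff_const
    exact (h1.continuous_fderiv one_ne_zero).clm_apply continuous_const
  have cPw : Continuous fun z => dt w z + lap w z := continuous_dt_add_lap_c12 hw1 hwx
  have cgw : Continuous (gradSq w) := continuous_gradSq_of_one hw1
  have cPχ : Continuous fun z => dt χ z + lap χ z := by
    simp only [dt, lap, dx]
    exact (cfdr hχ _).add (continuous_finsetSum _ fun i _ => cfd2r hχ _ _)
  have cgχ : Continuous (gradSq χ) := by
    show Continuous fun z => gradSq χ z
    simp only [gradSq, dx]
    exact continuous_finsetSum _ fun i _ => ((cfdr hχ _).norm.pow 2)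
  have cvO : ContinuousOn v O := hv.continuousOn
  have cgvO : ContinuousOn (gradSq v) O := continuousOn_gradSq_c1 hO hv
  -- ### integrability of all the weighted integrands
  have iw : Integrable fun z => W z * ‖w z‖ ^ 2 :=
    integrable_weight_mul hΩo hTc hTΩ hWc (cw.norm.pow 2) fun z hz => by simp [hw0 z hz]
  have igw : Integrable fun z => W z * gradSq w z :=
    integrable_weight_mul hΩo hTc hTΩ hWc cgw hgw0
  have iPw : Integrable fun z => W z * ‖dt w z + lap w z‖ ^ 2 :=
    integrable_weight_mul hΩo hTc hTΩ hWc (cPw.norm.pow 2) fun z hz => by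
      rw [hPw0 z hz]; simp
  have hWs1 : ContinuousOn (fun z : ℝ × E => Zw z * W z) Ω := cZ.mul hWc
  have hWs2 : ContinuousOn (fun z : ℝ × E => 1 / 2 * z.1 * W z) Ω :=
    (continuousOn_const.mul continuous_fst.continuousOn).mul hWc
  have hWs3 : ContinuousOn (fun z : ℝ × E => z.1 ^ 2 * W z) Ω := (continuous_fst.pow 2).continuousOn.mul hWc
  have iws1 : Integrable fun z => Zw z * W z * ‖w z‖ ^ 2 :=
    integrable_weight_mul hΩo hTc hTΩ hWs1 (cw.norm.pow 2) fun z hz => by simp [hw0 z hz]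
  have iws2 : Integrable fun z => 1 / 2 * z.1 * W z * gradSq w z :=
    integrable_weight_mul hΩo hTc hTΩ hWs2 cgw hgw0
  have iws3 : Integrable fun z => z.1 ^ 2 * W z * ‖dt w z + lap w z‖ ^ 2 :=
    integrable_weight_mul hΩo hTc hTΩ hWs3 (cPw.norm.pow 2) fun z hz => by
      rw [hPw0 z hz]; simp
  have iJ1 : Integrable fun z => W z * (gradSq χ z * ‖v z‖ ^ 2) :=
    integrable_weight_mul hΩo hTc hTΩ hWc
      (continuous_mul_of_eq_zero_off hO (isClosed_tsupport χ) hTO cgχ hgχ0 (cvO.norm.pow 2))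
      fun z hz => by simp [hgχ0 z hz]
  have iJ2 : Integrable fun z => W z * ((dt χ z + lap χ z) ^ 2 * ‖v z‖ ^ 2) :=
    integrable_weight_mul hΩo hTc hTΩ hWc
      (continuous_mul_of_eq_zero_off hO (isClosed_tsupport χ) hTO (cPχ.pow 2)
        (fun z hz => by rw [hdtχ0 z hz, hlapχ0 z hz]; simp) (cvO.norm.pow 2))
      fun z hz => by rw [hdtχ0 z hz, hlapχ0 z hz]; simp
  have iJ3 : Integrable fun z => W z * (gradSq χ z * gradSq v z) :=
    integrable_weight_mul hΩo hTc hTΩ hWc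
      (continuous_mul_of_eq_zero_off hO (isClosed_tsupport χ) hTO cgχ hgχ0 cgvO)
      fun z hz => by simp [hgχ0 z hz]
  -- ### the Carleman inequality and the lower bound of its left-hand side
  have hCarl0 := carleman_inequality_cone_of_c12 (E := E) (F := F) hβ hβ1 hε0 hηε hκ hm hc₂ ha0 ha he hw1 hwx hwc hws
  rw [one_mul] at hCarl0
  have hCarl : ∫ z, (Zw z * W z * ‖w z‖ ^ 2 + 1 / 2 * z.1 * W z * gradSq w z) ≤
      ∫ z, z.1 ^ 2 * W z * ‖dt w z + lap w z‖ ^ 2 := by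
    have e1 : ∀ z, Zw z * W z * ‖w z‖ ^ 2 + 1 / 2 * z.1 * W z * gradSq w z =
        Zw z * Real.exp (2 * conePhi a β η e z) * ‖w z‖ ^ 2 +
          1 / 2 * z.1 * Real.exp (2 * conePhi a β η e z) * gradSq w z := fun z => rfl
    exact hCarl0
  have hLHS : (∫ z, W z * ‖w z‖ ^ 2) + 1 / 4 * (∫ z, W z * gradSq w z) ≤
      ∫ z, (Zw z * W z * ‖w z‖ ^ 2 + 1 / 2 * z.1 * W z * gradSq w z) := by
    rw [← integral_const_mul, ← integral_add iw (igw.const_mul _)]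
    refine integral_mono (iw.add (igw.const_mul _)) (iws1.add iws2) fun z => ?_
    show W z * ‖w z‖ ^ 2 + 1 / 4 * (W z * gradSq w z) ≤ Zw z * W z * ‖w z‖ ^ 2 + 1 / 2 * z.1 * W z * gradSq w z
    by_cases hz : z ∈ tsupport χ
    · have hzΩ := hTΩ hz
      have hWz : 0 ≤ W z := hW0 z
      have hz0 : 1 / 2 < z.1 := hzΩ.1.1
      have hZ1 : 1 ≤ Zw z := hZ z hz
      have h1 : W z * ‖w z‖ ^ 2 ≤ Zw z * W z * ‖w z‖ ^ 2 := by
        have := mul_le_mul_of_nonneg_right hZ1 (mul_nonneg hWz (sq_nonneg ‖w z‖))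
        linarith [this]
      have h2 : 1 / 4 * (W z * gradSq w z) ≤ 1 / 2 * z.1 * W z * gradSq w z := by
        have := mul_le_mul_of_nonneg_right (by linarith : (1 / 4 : ℝ) ≤ 1 / 2 * z.1)
          (mul_nonneg hWz (gradSq_nonneg w z))
        linarith [this]
      exact add_le_add h1 h2
    · simp [hw0 z hz, hgw0 z hz]
  have hRHS0 : ∫ z, z.1 ^ 2 * W z * ‖dt w z + lap w z‖ ^ 2 ≤ ∫ z, W z * ‖dt w z + lap w z‖ ^ 2 := by
    refine integral_mono iws3 iPw fun z => ?_
    show z.1 ^ 2 * W z * ‖dt w z + lap w z‖ ^ 2 ≤ W z * ‖dt w z + lap w z‖ ^ 2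
    by_cases hz : z ∈ tsupport χ
    · have hzΩ := hTΩ hz
      have ht2 : z.1 ^ 2 ≤ 1 := by nlinarith [hzΩ.1.1, hzΩ.1.2]
      have := mul_le_mul_of_nonneg_right ht2 (mul_nonneg (hW0 z) (sq_nonneg ‖dt w z + lap w z‖))
      linarith [this]
    · rw [hPw0 z hz]; simp
  -- ### the pointwise bound and its integral
  have hP : ∀ z, W z * ‖dt w z + lap w z‖ ^ 2 ≤
      6 * c ^ 2 * (W z * ‖w z‖ ^ 2 + 2 * (W z * gradSq w z) +
        2 * (W z * (gradSq χ z * ‖v z‖ ^ 2))) +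
      3 * (W z * ((dt χ z + lap χ z) ^ 2 * ‖v z‖ ^ 2)) +
      12 * (W z * (gradSq χ z * gradSq v z)) := by
    intro z
    by_cases hz : z ∈ tsupport χ
    · have hWz : 0 ≤ W z := hW0 z
      have h := mul_le_mul_of_nonneg_left
        (norm_sq_dt_add_lap_smul_le_c12 hO hχ hv hvx (hTO hz) (hχ0 z) (hBH z (hTO hz))) hWz
      refine h.trans (le_of_eq ?_)
      simp only [hw]
      ring
    · rw [hPw0 z hz, hw0 z hz, hgw0 z hz, hgχ0 z hz, hdtχ0 z hz, hlapχ0 z hz]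
      simp
  have hRHS : ∫ z, W z * ‖dt w z + lap w z‖ ^ 2 ≤
      6 * c ^ 2 * ((∫ z, W z * ‖w z‖ ^ 2) + 2 * (∫ z, W z * gradSq w z) +
        2 * ∫ z, W z * (gradSq χ z * ‖v z‖ ^ 2)) +
      3 * (∫ z, W z * ((dt χ z + lap χ z) ^ 2 * ‖v z‖ ^ 2)) +
      12 * ∫ z, W z * (gradSq χ z * gradSq v z) := by
    have iA0 : Integrable fun z => W z * ‖w z‖ ^ 2 + 2 * (W z * gradSq w z) +
        2 * (W z * (gradSq χ z * ‖v z‖ ^ 2)) := (iw.add (igw.const_mul 2)).add (iJ1.const_mul 2)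
    have iA : Integrable fun z => 6 * c ^ 2 * (W z * ‖w z‖ ^ 2 + 2 * (W z * gradSq w z) +
        2 * (W z * (gradSq χ z * ‖v z‖ ^ 2))) := iA0.const_mul _
    have iB : Integrable fun z => 3 * (W z * ((dt χ z + lap χ z) ^ 2 * ‖v z‖ ^ 2)) :=
      iJ2.const_mul 3
    have iC : Integrable fun z => 12 * (W z * (gradSq χ z * gradSq v z)) := iJ3.const_mul 12
    have iAB : Integrable fun z => 6 * c ^ 2 * (W z * ‖w z‖ ^ 2 + 2 * (W z * gradSq w z) +
        2 * (W z * (gradSq χ z * ‖v z‖ ^ 2))) + 3 * (W z * ((dt χ z + lap χ z) ^ 2 * ‖v z‖ ^ 2)) := iA.add iB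
    have hmono : ∫ z, W z * ‖dt w z + lap w z‖ ^ 2 ≤
        ∫ z, (6 * c ^ 2 * (W z * ‖w z‖ ^ 2 + 2 * (W z * gradSq w z) +
          2 * (W z * (gradSq χ z * ‖v z‖ ^ 2))) +
          3 * (W z * ((dt χ z + lap χ z) ^ 2 * ‖v z‖ ^ 2)) +
          12 * (W z * (gradSq χ z * gradSq v z))) := integral_mono iPw (iAB.add iC) hP
    have i2g : Integrable fun z => 2 * (W z * gradSq w z) := igw.const_mul 2
    have i2J : Integrable fun z => 2 * (W z * (gradSq χ z * ‖v z‖ ^ 2)) := iJ1.const_mul 2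
    have iwg : Integrable fun z => W z * ‖w z‖ ^ 2 + 2 * (W z * gradSq w z) := iw.add i2g
    rw [integral_add iAB iC, integral_add iA iB, integral_const_mul, integral_add iwg i2J,
      integral_add iw i2g, integral_const_mul, integral_const_mul, integral_const_mul, integral_const_mul] at hmono
    exact hmono
  -- ### absorption
  have hI0w : 0 ≤ ∫ z, W z * ‖w z‖ ^ 2 := integral_nonneg fun z => mul_nonneg (hW0 z) (sq_nonneg _)
  have hI0g : 0 ≤ ∫ z, W z * gradSq w z :=
    integral_nonneg fun z => mul_nonneg (hW0 z) (gradSq_nonneg w z)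
  have hJ10 : 0 ≤ ∫ z, W z * (gradSq χ z * ‖v z‖ ^ 2) :=
    integral_nonneg fun z => mul_nonneg (hW0 z) (mul_nonneg (gradSq_nonneg χ z) (sq_nonneg _))
  have hJ20 : 0 ≤ ∫ z, W z * ((dt χ z + lap χ z) ^ 2 * ‖v z‖ ^ 2) :=
    integral_nonneg fun z => mul_nonneg (hW0 z) (mul_nonneg (sq_nonneg _) (sq_nonneg _))
  have hJ30 : 0 ≤ ∫ z, W z * (gradSq χ z * gradSq v z) :=
    integral_nonneg fun z => mul_nonneg (hW0 z) (mul_nonneg (gradSq_nonneg χ z) (gradSq_nonneg v z))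
  have hchain := ((hLHS.trans hCarl).trans hRHS0).trans hRHS
  -- ### the left-hand side on `G`
  have hG : ∫ z in G, W z * ‖v z‖ ^ 2 ≤ ∫ z, W z * ‖w z‖ ^ 2 := by
    have e : ∫ z in G, W z * ‖v z‖ ^ 2 = ∫ z in G, W z * ‖w z‖ ^ 2 :=
      setIntegral_congr_fun hGm fun z hz => by simp [hw, hG1 z hz]
    rw [e]
    exact setIntegral_le_integral iw (Eventually.of_forall fun z => mul_nonneg (hW0 z) (sq_nonneg _))
  generalize (∫ z, W z * ‖w z‖ ^ 2) = Iw at *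
  generalize (∫ z, W z * gradSq w z) = Ig at *
  generalize (∫ z, W z * (gradSq χ z * ‖v z‖ ^ 2)) = J1 at *
  generalize (∫ z, W z * ((dt χ z + lap χ z) ^ 2 * ‖v z‖ ^ 2)) = J2 at *
  generalize (∫ z, W z * (gradSq χ z * gradSq v z)) = J3 at *
  have h6 : 6 * c ^ 2 * (Iw + 2 * Ig + 2 * J1) ≤ (1 / 16) * (Iw + 2 * Ig + 2 * J1) := by
    have hIP0 : 0 ≤ Iw + 2 * Ig + 2 * J1 := by linarith
    have hcc : 6 * c ^ 2 ≤ 1 / 16 := by linarith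
    exact mul_le_mul_of_nonneg_right hcc hIP0
  nlinarith [hchain, h6, hI0w, hI0g, hJ10, hJ20, hJ30, hG]

end ConeCarlemanC12

end Carleman

end Literature.Analysis.FluidPDE
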